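/-
Copyright: the b2b-balaban T⁴-continuum CRUX team, row NE7b OWNER lineage `t4-ne7b-p1` (gen 130). Project licence.
-/
import Summits.QuantumFields.BalabanUV.T4Continuum.Spine.NE7b.SupLargeFieldPenaltyPaid
import Summits.QuantumFields.BalabanUV.T4Continuum.Spine.NE7b.SupLargeFieldRegionsRare

/-!
# THE LARGE-FIELD PENALTY IS PAID LOCALLY — THE WEIGHTED PEIERLS SUM OVER REGIONS THROUGH A CELL: under the next Gaussian `N(0,Γ)` with
# `Γ ⪯ γ_op·1`, diagonal `≤ γ`, disjoint cells of `≤ v` sites and an adjacency `R` with `≤ Δ` neighbours, for EVERY finite family `𝒴` of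
# `R`-connected cell sets containing a fixed cell `q` and every penalty weight `e^{a}e^{bΣ_{cell p}ψ²}` with `b ≤ κ∕2`:
#   `Σ_{L∈𝒴} ∫ ∏_{p∈L}(1_{Ψ²≤Σ_{cell p}ψ²}·e^{a}·e^{bΣ_{cell p}ψ²}) dN(0,Γ)(ψ) ≤ 2η″`,  `η″ = e^{a}·e^{−(κ∕2−b)Ψ²}·A^v`,  whenever `(Δ+1)²η″ ≤ ½`
# — (308)'s weighted Peierls brick `(η″)^{#L}` resummed by the tree's lattice-animal estimate exactly as (304) resummed the unweighted one: the
# LOCAL form of the two-scale theorem (309) (whose penalty `∏_{p∈C}(1 + 1_{p large}e^{a}e^{bΣψ²})` is extensive), i.e. the large-field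
# regions through a cell, WITH their quadratic penalty, are summable with no volume factor (row NE7b, node U5c; (304)∕(308) + the tree's
# `PolymerGasGeometric.sum_pow_card_le_of_connected` BY NAME; [folklore])

Cell `pub-balaban`, sub-cell `t4`, spine estimate NE7b (`T4WeightBudget.RelWeightBound`; the cell's OWN estimate — NOT PRINTED in
[Bałaban 1983–89], NOT PROVED).  Crux-route work under `Spine/NE7b/` by the row OWNER (`t4-ne7b-p1` gen 130, file (335)) under FREEZE
(0)'s crux-prover clause, on § [NE7bP1-G129-HANDOFF] NEXT (iii) («the LOCAL two-scale statement via (304)»); NOTHING of Bałaban's is named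
as a Lean object, valued or asserted; no `T4Continuum/Support` leaf typed; no `def`, no notation; zero `sorry`.  Imports (BY NAME): the
OWNER's (308) `…SupLargeFieldPenaltyPaid` (`integral_prod_cellWeight_le`, `integrable_prod_cellWeight`), (304) `…SupLargeFieldRegionsRare`
(pattern), the tree's `Literature/Probability/LatticeModels/PolymerGasGeometric` (`sum_pow_card_le_of_connected`), Mathlib's
`integral_finsetSum`, `integral_nonneg`.

WHAT IS PROVED ([folklore]):
* §1 **`sum_integral_prod_cellWeight_le`** (the weighted Peierls sum `≤ 2η″`), **`integral_sum_prod_cellWeight_le`** (the same for the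
  integral of the summed weight `Σ_{L∈𝒴}∏_{p∈L}(…)` — it dominates the weight of ANY single region of the family, in particular of the
  large-field component of `q`), `integral_prod_cellWeight_le_of_mem` (one region of the family: `≤ 2η″`);
* §2 `eta_weighted_small_of` (bookkeeping: `(Δ+1)²η″ ≤ ½` from `e^{a}e^{−(κ∕2−b)Ψ²} ≤ δ` and `(Δ+1)²A^vδ ≤ ½`); §3 toy.

HONEST (what this is NOT).  The families `𝒴` are supplied by the consumer (all `R`-connected cell sets through `q` inside a volume — the bound
is uniform in the family); the identification «penalty of (309) restricted to the component of `q`» ≤ «summed weight over `𝒴`» is the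
consumer's one-line use; one pair of scales; scalar skeleton ((A3), NC-NE7b-α UNRULED); nothing of Bałaban's asserted.  BY-NAME EFFECT ON THE
WALL: NONE.  NE7b NOT PRINTED ∕ NOT PROVED; spine PROVED 0∕9; rung (B)+1 — the programme's measures remain FINITE-torus statements; NOT the
mass gap, NOT Clay.  HONEST DEPENDENCY: continuum YM on T⁴ ⇐ BetaPertH ∧ nine spine estimates (0∕9 proved); BetaPertH ⇐ (D1) ∧ (D4) ∧
CAP+tail; G-an2-4 gates asym, D1 and NE2∕3∕4.
-/

set_option autoImplicit false

noncomputable section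

namespace Summit.QuantumFields.BalabanUV.T4Continuum.NE7b.SupLargeFieldRegionsPaid

open MeasureTheory ProbabilityTheory Finset Real
open scoped BigOperators
open Literature.Probability.LatticeModels (IsRConnected sum_pow_card_le_of_connected)
open SupLargeFieldPenaltyPaid (integral_prod_cellWeight_le integrable_prod_cellWeight)

variable {ι : Type} [Fintype ι] [DecidableEq ι] {V : Type*} [DecidableEq V]

/-! ## §1. The weighted Peierls sum over region shapes -/

/-- **THE WEIGHTED PEIERLS SUM**: `Γ ⪰ 0`, `Γ ⪯ γ_op·1`, diagonal `≤ γ` (`γ ≥ 0`); disjoint cells of `≤ v` sites; `R` symmetric with `≤ Δ`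
neighbours listed by `nbr`; `0 ≤ κ`, `0 < θ < 1`, `κγ_op ≤ θ`, `b ≤ κ∕2`; `η″ = e^{a}e^{−(κ∕2−b)Ψ²}A^v` with `(Δ+1)²η″ ≤ ½` ⟹ for every cell `q`
and every finite family `𝒴` of `R`-connected cell sets containing `q`:
`Σ_{L∈𝒴} ∫∏_{p∈L}(1_{Ψ²≤Σ_{cell p}ψ²}·e^{a}·e^{bΣ_{cell p}ψ²}) dN(0,Γ) ≤ 2η″`. [folklore] -/
theorem sum_integral_prod_cellWeight_le {Γ : Matrix ι ι ℝ} {γop γ : ℝ} (hΓ : Γ.PosSemidef)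
    (hΓop : (γop • (1 : Matrix ι ι ℝ) - Γ).PosSemidef) (hdiag : ∀ i, Γ i i ≤ γ) (hγ : 0 ≤ γ) (cell : V → Finset ι)
    (hdisj : ∀ p q, p ≠ q → Disjoint (cell p) (cell q)) {v : ℕ} (hv : ∀ p, (cell p).card ≤ v) {R : V → V → Prop}
    (hR : ∀ x y, R x y → R y x) {nbr : V → Finset V} {Δ : ℕ} (hΔ : ∀ x, (nbr x).card ≤ Δ) (hnbr : ∀ x y, R x y → y ∈ nbr x)
    {κ θ b : ℝ} (hκ : 0 ≤ κ) (hθ0 : 0 < θ) (hθ1 : θ < 1) (hκθ : κ * γop ≤ θ) (hb : b ≤ κ / 2) (Ψ a : ℝ)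
    (hsmall : ((Δ : ℝ) + 1) ^ 2 * (exp a * (exp (-((κ / 2 - b) * Ψ ^ 2)) * ((1 - θ) ^ (-(κ * γ / (2 * θ)))) ^ v)) ≤ 1 / 2)
    (q : V) (𝒴 : Finset (Finset V)) (h𝒴 : ∀ L ∈ 𝒴, q ∈ L ∧ IsRConnected R L) :
    ∑ L ∈ 𝒴, ∫ ω : EuclideanSpace ℝ ι, ∏ p ∈ L, ((if Ψ ^ 2 ≤ ∑ x ∈ cell p, ω x ^ 2 then (1 : ℝ) else 0) *
        (exp a * exp (b * ∑ x ∈ cell p, ω x ^ 2))) ∂(multivariateGaussian 0 Γ) ≤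
      2 * (exp a * (exp (-((κ / 2 - b) * Ψ ^ 2)) * ((1 - θ) ^ (-(κ * γ / (2 * θ)))) ^ v)) := by
  set η : ℝ := exp a * (exp (-((κ / 2 - b) * Ψ ^ 2)) * ((1 - θ) ^ (-(κ * γ / (2 * θ)))) ^ v) with hη
  have hη0 : 0 ≤ η := mul_nonneg (exp_pos _).le (mul_nonneg (exp_pos _).le (pow_nonneg (rpow_nonneg (by linarith) _) _))
  calc ∑ L ∈ 𝒴, ∫ ω : EuclideanSpace ℝ ι, ∏ p ∈ L, ((if Ψ ^ 2 ≤ ∑ x ∈ cell p, ω x ^ 2 then (1 : ℝ) else 0) *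
          (exp a * exp (b * ∑ x ∈ cell p, ω x ^ 2))) ∂(multivariateGaussian 0 Γ)
      ≤ ∑ L ∈ 𝒴, η ^ L.card :=
        sum_le_sum fun L _ => integral_prod_cellWeight_le hΓ hΓop hdiag hγ cell hdisj hv hκ hθ0 hθ1 hκθ hb L Ψ a
    _ ≤ 2 * η := sum_pow_card_le_of_connected hR hΔ hnbr hη0 hsmall q 𝒴 h𝒴

/-- **THE SUMMED WEIGHT OF THE FAMILY HAS INTEGRAL `≤ 2η″`**: under the same hypotheses,
`∫ Σ_{L∈𝒴}∏_{p∈L}(1_{p large}e^{a}e^{bΣ_{cell p}ψ²}) dN(0,Γ) ≤ 2η″` — the summed weight dominates the penalty weight of any single region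
of `𝒴`, in particular of the large-field component of `q`; a LOCAL estimate, with no volume factor. [folklore] -/
theorem integral_sum_prod_cellWeight_le {Γ : Matrix ι ι ℝ} {γop γ : ℝ} (hΓ : Γ.PosSemidef)
    (hΓop : (γop • (1 : Matrix ι ι ℝ) - Γ).PosSemidef) (hdiag : ∀ i, Γ i i ≤ γ) (hγ : 0 ≤ γ) (cell : V → Finset ι)
    (hdisj : ∀ p q, p ≠ q → Disjoint (cell p) (cell q)) {v : ℕ} (hv : ∀ p, (cell p).card ≤ v) {R : V → V → Prop}
    (hR : ∀ x y, R x y → R y x) {nbr : V → Finset V} {Δ : ℕ} (hΔ : ∀ x, (nbr x).card ≤ Δ) (hnbr : ∀ x y, R x y → y ∈ nbr x)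
    {κ θ b : ℝ} (hκ : 0 ≤ κ) (hθ0 : 0 < θ) (hθ1 : θ < 1) (hκθ : κ * γop ≤ θ) (hb : b ≤ κ / 2) (Ψ a : ℝ)
    (hsmall : ((Δ : ℝ) + 1) ^ 2 * (exp a * (exp (-((κ / 2 - b) * Ψ ^ 2)) * ((1 - θ) ^ (-(κ * γ / (2 * θ)))) ^ v)) ≤ 1 / 2)
    (q : V) (𝒴 : Finset (Finset V)) (h𝒴 : ∀ L ∈ 𝒴, q ∈ L ∧ IsRConnected R L) :
    ∫ ω : EuclideanSpace ℝ ι, ∑ L ∈ 𝒴, ∏ p ∈ L, ((if Ψ ^ 2 ≤ ∑ x ∈ cell p, ω x ^ 2 then (1 : ℝ) else 0) *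
        (exp a * exp (b * ∑ x ∈ cell p, ω x ^ 2))) ∂(multivariateGaussian 0 Γ) ≤
      2 * (exp a * (exp (-((κ / 2 - b) * Ψ ^ 2)) * ((1 - θ) ^ (-(κ * γ / (2 * θ)))) ^ v)) := by
  rw [integral_finsetSum _ fun L _ => integrable_prod_cellWeight hΓ hΓop cell hdisj hκ hθ1 hκθ hb L Ψ a]
  exact sum_integral_prod_cellWeight_le hΓ hΓop hdiag hγ cell hdisj hv hR hΔ hnbr hκ hθ0 hθ1 hκθ hb Ψ a hsmall q 𝒴 h𝒴

omit [Fintype ι] [DecidableEq ι] [DecidableEq V] in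
/-- The penalty weight of a region is nonnegative. [folklore] -/
theorem prod_cellWeight_nonneg (cell : V → Finset ι) (L : Finset V) (Ψ a b : ℝ) (ω : EuclideanSpace ℝ ι) :
    0 ≤ ∏ p ∈ L, ((if Ψ ^ 2 ≤ ∑ x ∈ cell p, ω x ^ 2 then (1 : ℝ) else 0) * (exp a * exp (b * ∑ x ∈ cell p, ω x ^ 2))) :=
  prod_nonneg fun p _ => mul_nonneg (by split_ifs <;> norm_num) (by positivity)

/-- **ONE REGION OF THE FAMILY**: under the same hypotheses, for every `L ∈ 𝒴`,
`∫∏_{p∈L}(1_{p large}e^{a}e^{bΣ_{cell p}ψ²}) dN(0,Γ) ≤ 2η″` (a term of the nonnegative sum). [folklore] -/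
theorem integral_prod_cellWeight_le_of_mem {Γ : Matrix ι ι ℝ} {γop γ : ℝ} (hΓ : Γ.PosSemidef)
    (hΓop : (γop • (1 : Matrix ι ι ℝ) - Γ).PosSemidef) (hdiag : ∀ i, Γ i i ≤ γ) (hγ : 0 ≤ γ) (cell : V → Finset ι)
    (hdisj : ∀ p q, p ≠ q → Disjoint (cell p) (cell q)) {v : ℕ} (hv : ∀ p, (cell p).card ≤ v) {R : V → V → Prop}
    (hR : ∀ x y, R x y → R y x) {nbr : V → Finset V} {Δ : ℕ} (hΔ : ∀ x, (nbr x).card ≤ Δ) (hnbr : ∀ x y, R x y → y ∈ nbr x)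
    {κ θ b : ℝ} (hκ : 0 ≤ κ) (hθ0 : 0 < θ) (hθ1 : θ < 1) (hκθ : κ * γop ≤ θ) (hb : b ≤ κ / 2) (Ψ a : ℝ)
    (hsmall : ((Δ : ℝ) + 1) ^ 2 * (exp a * (exp (-((κ / 2 - b) * Ψ ^ 2)) * ((1 - θ) ^ (-(κ * γ / (2 * θ)))) ^ v)) ≤ 1 / 2)
    (q : V) (𝒴 : Finset (Finset V)) (h𝒴 : ∀ L ∈ 𝒴, q ∈ L ∧ IsRConnected R L) {L : Finset V} (hL : L ∈ 𝒴) :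
    ∫ ω : EuclideanSpace ℝ ι, ∏ p ∈ L, ((if Ψ ^ 2 ≤ ∑ x ∈ cell p, ω x ^ 2 then (1 : ℝ) else 0) *
        (exp a * exp (b * ∑ x ∈ cell p, ω x ^ 2))) ∂(multivariateGaussian 0 Γ) ≤
      2 * (exp a * (exp (-((κ / 2 - b) * Ψ ^ 2)) * ((1 - θ) ^ (-(κ * γ / (2 * θ)))) ^ v)) := by
  refine le_trans ?_ (sum_integral_prod_cellWeight_le hΓ hΓop hdiag hγ cell hdisj hv hR hΔ hnbr hκ hθ0 hθ1 hκθ hb Ψ a hsmall q 𝒴 h𝒴)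
  exact single_le_sum (f := fun L => ∫ ω : EuclideanSpace ℝ ι, ∏ p ∈ L, ((if Ψ ^ 2 ≤ ∑ x ∈ cell p, ω x ^ 2 then (1 : ℝ) else 0) *
      (exp a * exp (b * ∑ x ∈ cell p, ω x ^ 2))) ∂(multivariateGaussian 0 Γ))
    (fun L _ => integral_nonneg fun ω => prod_cellWeight_nonneg cell L Ψ a b ω) hL

/-! ## §2. Bookkeeping: when is `η″` small -/

/-- `(Δ+1)²η″ ≤ ½` follows from `e^{a}e^{−(κ∕2−b)Ψ²} ≤ δ`, `0 ≤ A`, and `(Δ+1)²·A^v·δ ≤ ½`. [folklore] -/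
theorem eta_weighted_small_of {Δ v : ℕ} {κ b Ψ A δ a : ℝ} (hA : 0 ≤ A) (hexp : exp a * exp (-((κ / 2 - b) * Ψ ^ 2)) ≤ δ)
    (hδ : ((Δ : ℝ) + 1) ^ 2 * A ^ v * δ ≤ 1 / 2) :
    ((Δ : ℝ) + 1) ^ 2 * (exp a * (exp (-((κ / 2 - b) * Ψ ^ 2)) * A ^ v)) ≤ 1 / 2 := by
  have h1 : 0 ≤ ((Δ : ℝ) + 1) ^ 2 * A ^ v := mul_nonneg (by positivity) (pow_nonneg hA _)
  calc ((Δ : ℝ) + 1) ^ 2 * (exp a * (exp (-((κ / 2 - b) * Ψ ^ 2)) * A ^ v))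
      = ((Δ : ℝ) + 1) ^ 2 * A ^ v * (exp a * exp (-((κ / 2 - b) * Ψ ^ 2))) := by ring
    _ ≤ ((Δ : ℝ) + 1) ^ 2 * A ^ v * δ := mul_le_mul_of_nonneg_left hexp h1
    _ ≤ 1 / 2 := hδ

/-! ## §3. Toy -/

/-- Toy (§2): with `Δ = 0`, `v = 0`, `A = 1`, `a = 0` and `δ = ½`, the tail `e^{0}e^{−(κ∕2−b)Ψ²} ≤ ½` makes `η″` small. -/
example {κ b Ψ : ℝ} (h : exp 0 * exp (-((κ / 2 - b) * Ψ ^ 2)) ≤ 1 / 2) :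
    (((0 : ℕ) : ℝ) + 1) ^ 2 * (exp 0 * (exp (-((κ / 2 - b) * Ψ ^ 2)) * (1 : ℝ) ^ (0 : ℕ))) ≤ 1 / 2 :=
  eta_weighted_small_of (v := 0) zero_le_one h (by norm_num)

end Summit.QuantumFields.BalabanUV.T4Continuum.NE7b.SupLargeFieldRegionsPaid
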